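import Literature.MathematicalPhysics.QuantumFieldTheory.Balaban1983to89.B2Sect2Statements
import Literature.MathematicalPhysics.QuantumFieldTheory.Balaban1983to89.B2Eq238ScalarBoundary

/-!
# `Balaban1983to89.B2Prop26DiffTerms` — [Balaban1982Higgs2] Proposition 2.6 p. 580 (the change of the propagator in
the interaction terms costs `O((Lᵏε)^κ)|Λ₇^{(k)}|`): the decl of record `B2Sect2Statements.Prop26Printed κ` INHABITED,
for EVERY real `κ`, by the schematic family of LOCALIZED TERMS WITH ONE PROPAGATOR-DIFFERENCE LINE under the printed
δ-clause of Proposition I.2.1 / 2.2 — kind «model instance» (no proof is printed; the evident one-line mechanism)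

statement-level skeleton of published theorems with citation tags; proofs where landed; nothing here is a claim about the Yang–Mills mass gap

PDF held: `paper:balaban1982-cmp86-higgs23-ii` (T. Bałaban, *(Higgs)₂,₃ quantum fields in a finite volume. II. An upper
bound*, Commun. Math. Phys. **86** (1982) 555–594, doi 10.1007/bf01214890; journal page = PDF page + 554); pp. 568, 570–571,
580 [PDF 14, 16–17, 26] READ AS IMAGES on the ×2 renders
`run/shared/lean/pub/pub-balaban/b2b-balaban-ref1/pages/1982-cmp86-higgs23-II/1982-cmp86-higgs23-II-p014|p016|p017|p026-x2.png`;
part I [Balaban1982Higgs1] Prop. 2.1 (2.24)–(2.26) p. 610 [PDF 8] likewise.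

CITATION HEADER — WHAT IS REPRODUCED.  SKELETON row **B2.Prop2.6** (Prop. 2.6 p. 580; decl of record
`B2Sect2Statements.Prop26Printed κ` over the carrier `P26Setting`, typed p239259 r02; twin `B2StepK.Prop26Printed` r14,
bridged by `B2StepKSect2Bridge.prop26Printed_of_sect2`): this file builds the family `diffTermFam K` of `P26Setting`
instances «one interaction term localized in Bᵏ(Λ₇^{(k)}) containing a propagator-difference line, its other factors
bounded by their (2.55)-thresholds» and PROVES `Prop26Printed κ (diffTermFam K)` for every real κ (`prop26Printed_diffTerms`;
in particular for the κ > d of p. 568), plus non-vacuity (`ctx_witness`).  Unit `lit-balaban-p15` gen 5 (Phase-2 proof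
seat p15; HOME `run/shared/lean/pub/lit-balaban/`, seat dir `lit-balaban-p15/`); B2 fold owner r02, second reader r14;
referee ref-4.  Inputs BY NAME: r02's `B2Sect2Statements.P26Setting`/`Prop26Printed` (p239259), the seat's gen-3
`B2Eq238ScalarBoundary.decay_thresholds_pow₂` (p250054) on r14's `B2StepK.rDecayBeatsPowers` (p240722), `B2.pFn`/`B2.rFn`.

WHAT IS PRINTED (p. 580 [PDF 26], verbatim).  *"Proposition 2.6. If in the interaction terms localized in Bᵏ(Λ₇^{(k)})
we replace the propagator G_k(B^{k−1}(Λ₂^{(k−1)}), B̃) by G_k(Bᵏ(Λ₂^{(k)}), B^{(k+1),η}), then all the terms containing at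
least one difference of these propagators can be estimated by O((Lᵏε)^κ)|Λ₇^{(k)}|."*  No proof is printed (p. 570, on
Prop. 2.1: *"This theorem is a corollary of the analysis of the perturbation expansions"*; p. 568: *"We use
Proposition I.2.1 and restrictions on the fields, and we estimate unnecessary terms by O((L^{k−1}ε)^κ)|Λ₆^{(k−1)}| with
κ > d"*).  The input, part I Prop. 2.1 p. 610 [PDF 8], verbatim: *"|(D^η_{A,μ}G_k(Ω, A)f)(x)|, |(G_k(Ω, A)f)(x)| ≦
c₀exp(−δ₀dist(x, supp f))‖f‖_∞ (2.25) for x ∈ Ω, dist(x, Ωᶜ) ≧ R₀. If Ω ⊂ Ω₀, then for δG_k(Ω, Ω₀, A) defined by the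
equality δG_k(Ω, Ω₀, A) = G_k(Ω, A) − G_k(Ω₀, A), (2.26) we have the inequalities (2.24), (2.25) with the additional
factor exp(−δ₀dist(supp f, Ωᶜ) − δ₀dist({x, x′}, Ωᶜ))"* (part II Prop. 2.2 p. 571: *"This proposition is a simple
corollary of Proposition I.2.1"*); here `Ω = Bᵏ(Λ₂^{(k)}) ⊂ Ω₀ = B^{k−1}(Λ₂^{(k−1)})` and `B̃ = B^{(k+1),η}` on `Ω`
(p. 582: B̃ = (1 − θ_{k+1})θ_kA^{(k)} + θ_{k+1}B^{(k+1),η}), so the replaced difference is `−δG_k(Ω, Ω₀, B̃)`; the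
localization `Bᵏ(Λ₇^{(k)})` lies `≥ 5r(Lᵏε)` layers inside `Ω` by the geometry (2.8) p. 558; the other factors of a
term obey the restrictions (2.55) p. 570 (thresholds `c₁p(ℓ)`, `c₁p(ℓ)/(μ₀ℓ)`, `c₁p(ℓ)/λ(ℓ)^{1/4}`, ℓ = L^{k−1}ε or Lᵏε).

THE MODEL (schematic, kind «model instance»; the print gives no proof and no list of terms).  ONE term localized in
`Bᵏ(Λ₇^{(k)})` containing a propagator-difference line is read, after bounding its remaining factors, as
`T = Σ_{x ∈ V} η^d · a(x) · (δG f)(x)` with: `V` ↤ the vertices in `Bᵏ(Λ₇^{(k)})` (`η^d·#V ≤ |Λ₇^{(k)}|`, the *"measure of a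
set rescaled to the unit lattice"*), `a` ↤ the local field factor at the vertex (`|a| ≤ K_a·p(ℓ)·ℓ^{−m_a}`, a (2.55)
threshold power), `f` ↤ the factor entering the other end of the difference line (`|f| ≤ K_f·p(ℓ)·ℓ^{−m_f}`, supported in
the localization: `dist(supp f, Ωᶜ) ≥ R`), `δG` ↤ the difference of the two propagators as an operator with the PRINTED
δ-clause (2.25)–(2.26) for this `f` at the vertices (`|(δG f)(x)| ≤ c₀‖f‖_∞e^{−δ₀(dist(supp f,Ωᶜ) + dist(x,Ωᶜ))}`, the
factor `e^{−δ₀dist(x,supp f)} ≤ 1` dropped), and the separation `R ≥ r(ℓ)` of (2.8) (`dist(x, Ωᶜ) ≥ R` on `V`).  Terms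
with several difference lines are of the same form (the further lines are bounded factors).  The family `diffTermFam K`
ranges over ALL such data on all finite vertex sets (`Fin n`), for the fixed constants `K` (`c₀, δ₀` of Prop. I.2.1;
`b₀, p` of p(ε); `R, r` of r(ε); the threshold shapes `K_a, m_a, K_f, m_f`).

WHAT IS KERNEL-CHECKED (zero `sorry`, standard axioms).  `Consts`, `Consts.Printed`, `Datum`, `Datum.thrA/thrF`,
`Datum.Ctx` (the standing context, = `P26Setting.ctx`), `Datum.diffTerm`, `toP26`, `diffTermFam` (definitions with
bodies); `abs_diffTerm_le` (`|T| ≤ |Λ₇|·c₀·e^{−2δ₀R}·T_aT_f`), `abs_diffTerm_le_pow` (`≤ c₀C_κ·ℓ^κ·|Λ₇|`),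
**`prop26Printed_diffTerms`** (`∀ κ, B2Sect2Statements.Prop26Printed κ (diffTermFam K)` for printed-range constants),
`prop26Printed_diffTerms_gt_d` (the p. 568 reading: some κ > d), `ctx_witness` (the context is satisfiable: the family is
not vacuous).
HONEST SCOPE.  This inhabits the decl of record by a SCHEMATIC family: the perturbation-expansion terms of (2.57)/part
III are not transcribed; a term enters through its thresholds and the printed δ-clause only; Prop. I.2.1 / Prop. 2.2
themselves are NOT proved here (rows B1.Prop2.1, B2.Prop2.2).
-/

namespace Literature.MathematicalPhysics.QuantumFieldTheory.Balaban1983to89.B2Prop26DiffTerms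

open Real
open B2Eq236Replacements (pFn_nonneg)
open B2Eq238ScalarBoundary (decay_thresholds_pow₂)

/-- The FIXED constants of the family: `c₀, δ₀` of Prop. I.2.1 / 2.2 ((2.25)–(2.26), (2.58)); `b₀, p` of
p(ε) = b₀(1 + log ε⁻¹)ᵖ (2.3); `Rr, r` of r(ε) = R(1 + log ε⁻¹)ʳ (2.7); the threshold shapes `K·p(ℓ)·ℓ^{−m}` of (2.55)
for the local factor (`Ka, ma`) and for the factor entering the difference line (`Kf, mf`).
[cite: Balaban1982Higgs2, Prop. 2.6 p.580] -/
structure Consts where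
  c₀ : ℝ
  δ₀ : ℝ
  b₀ : ℝ
  p : ℝ
  Rr : ℝ
  r : ℝ
  Ka : ℝ
  ma : ℝ
  Kf : ℝ
  mf : ℝ

/-- The printed ranges: `c₀ ≥ 0`, `δ₀ > 0` (Prop. I.2.1), `b₀ ≥ 0`, `p ≥ 0` ((2.3): p > 2), `R > 0`, `r > 1` ((2.7)),
`Ka, Kf ≥ 0`. [cite: Balaban1982Higgs2, (2.7) p.558] -/
structure Consts.Printed (K : Consts) : Prop where
  c₀_nonneg : 0 ≤ K.c₀
  δ₀_pos : 0 < K.δ₀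
  b₀_nonneg : 0 ≤ K.b₀
  p_nonneg : 0 ≤ K.p
  Rr_pos : 0 < K.Rr
  r_gt_one : 1 < K.r
  Ka_nonneg : 0 ≤ K.Ka
  Kf_nonneg : 0 ≤ K.Kf

/-- ONE interaction term localized in `Bᵏ(Λ₇^{(k)})` with a propagator-difference line, on a lattice with `n` fine
sites: `ℓ` ↤ Lᵏε; `wt` ↤ η^d; `V` ↤ its vertices in `Bᵏ(Λ₇^{(k)})`; `vol7` ↤ |Λ₇^{(k)}|; `a` ↤ the local field factor;
`f` ↤ the factor entering the other end of the difference line; `δG` ↤ the difference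
`G_k(B^{k−1}(Λ₂^{(k−1)}), B̃) − G_k(Bᵏ(Λ₂^{(k)}), B^{(k+1),η}) = −δG_k(Ω, Ω₀, B̃)` as an operator; `dΩc x` ↤ dist(x, Ωᶜ),
`Ω = Bᵏ(Λ₂^{(k)})`; `dsupp` ↤ dist(supp f, Ωᶜ); `R` ↤ the separation of (2.8). [cite: Balaban1982Higgs2, Prop. 2.6 p.580] -/
structure Datum (n : ℕ) where
  ℓ : ℝ
  wt : ℝ
  V : Finset (Fin n)
  vol7 : ℕ
  a : Fin n → ℝ
  f : Fin n → ℝ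
  δG : (Fin n → ℝ) → (Fin n → ℝ)
  dΩc : Fin n → ℝ
  dsupp : ℝ
  R : ℝ

namespace Datum

variable {n : ℕ}

/-- The (2.55) threshold for the local factor: `T_a(ℓ) = K_a·p(ℓ)·ℓ^{−m_a}`. [cite: Balaban1982Higgs2, (2.55) p.570] -/
noncomputable def thrA (K : Consts) (D : Datum n) : ℝ := K.Ka * B2.pFn K.b₀ K.p D.ℓ * D.ℓ ^ (-K.ma)

/-- The (2.55) threshold for the factor entering the difference line: `T_f(ℓ) = K_f·p(ℓ)·ℓ^{−m_f}`.
[cite: Balaban1982Higgs2, (2.55) p.570] -/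
noncomputable def thrF (K : Consts) (D : Datum n) : ℝ := K.Kf * B2.pFn K.b₀ K.p D.ℓ * D.ℓ ^ (-K.mf)

/-- THE STANDING CONTEXT of one term (`P26Setting.ctx`): the scale `ℓ = Lᵏε ∈ (0,1]`; `η^d ≥ 0` and the localization
volume `η^d·#V ≤ |Λ₇^{(k)}|`; the (2.55) thresholds on the two factors; the PRINTED δ-clause of Prop. I.2.1 (2.25)–(2.26)
for `δG` applied to `f` at the vertices, `|(δG f)(x)| ≤ c₀‖f‖_∞e^{−δ₀(dist(supp f,Ωᶜ) + dist(x,Ωᶜ))}`; the (2.8)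
separations `dist(supp f, Ωᶜ) ≥ R`, `dist(x, Ωᶜ) ≥ R` on `V`, `R ≥ r(ℓ)`. [cite: Balaban1982Higgs2, Prop. 2.6 p.580] -/
def Ctx (K : Consts) (D : Datum n) : Prop :=
  0 < D.ℓ ∧ D.ℓ ≤ 1 ∧ 0 ≤ D.wt ∧ D.wt * (D.V.card : ℝ) ≤ (D.vol7 : ℝ) ∧
    (∀ x ∈ D.V, |D.a x| ≤ D.thrA K) ∧ (∀ x, |D.f x| ≤ D.thrF K) ∧
    (∀ x ∈ D.V, |D.δG D.f x| ≤ K.c₀ * D.thrF K * Real.exp (-(K.δ₀ * (D.dsupp + D.dΩc x)))) ∧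
    D.R ≤ D.dsupp ∧ (∀ x ∈ D.V, D.R ≤ D.dΩc x) ∧ B2.rFn K.Rr K.r D.ℓ ≤ D.R

/-- THE TERM: `T = Σ_{x ∈ V} η^d·a(x)·(δG f)(x)` (`P26Setting.diffTerms`). [cite: Balaban1982Higgs2, Prop. 2.6 p.580] -/
def diffTerm (D : Datum n) : ℝ := ∑ x ∈ D.V, D.wt * (D.a x * D.δG D.f x)

end Datum

/-- The instance of r02's carrier for one term. [cite: Balaban1982Higgs2, Prop. 2.6 p.580] -/
def toP26 (K : Consts) {n : ℕ} (D : Datum n) : B2Sect2Statements.P26Setting :=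
  { scale := D.ℓ, ctx := D.Ctx K, diffTerms := D.diffTerm, vol7 := D.vol7 }

/-- THE FAMILY: all localized terms with a propagator-difference line, on all finite vertex sets, for the fixed
constants `K`. [cite: Balaban1982Higgs2, Prop. 2.6 p.580] -/
def diffTermFam (K : Consts) : (Σ n : ℕ, Datum n) → B2Sect2Statements.P26Setting := fun i => toP26 K i.2

/-! ## The estimate -/

section Estimate

variable {n : ℕ} (K : Consts) (D : Datum n)

/-- **One term, bounded**: under the context, `|T| ≤ |Λ₇^{(k)}|·(c₀·e^{−2δ₀R}·T_a·T_f)` — every vertex contributes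
`η^d·T_a·c₀T_fe^{−δ₀(dist(supp f,Ωᶜ) + dist(x,Ωᶜ))} ≤ η^d·T_a·c₀T_f·e^{−2δ₀R}` and `η^d·#V ≤ |Λ₇^{(k)}|`.
[cite: Balaban1982Higgs2, Prop. 2.6 p.580] -/
theorem abs_diffTerm_le (hK : K.Printed) (h : D.Ctx K) :
    |D.diffTerm| ≤ (D.vol7 : ℝ) * (K.c₀ * Real.exp (-(2 * K.δ₀ * D.R)) * D.thrA K * D.thrF K) := by
  obtain ⟨hℓ, hℓ1, hwt, hvol, ha, -, hδG, hRs, hRx, -⟩ := h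
  have hTa : 0 ≤ D.thrA K :=
    mul_nonneg (mul_nonneg hK.Ka_nonneg (pFn_nonneg hK.b₀_nonneg hℓ hℓ1)) (Real.rpow_nonneg hℓ.le _)
  have hTf : 0 ≤ D.thrF K :=
    mul_nonneg (mul_nonneg hK.Kf_nonneg (pFn_nonneg hK.b₀_nonneg hℓ hℓ1)) (Real.rpow_nonneg hℓ.le _)
  set M : ℝ := K.c₀ * Real.exp (-(2 * K.δ₀ * D.R)) * D.thrA K * D.thrF K with hM
  have hM0 : 0 ≤ M := by
    rw [hM]
    exact mul_nonneg (mul_nonneg (mul_nonneg hK.c₀_nonneg (Real.exp_pos _).le) hTa) hTf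
  have hterm : ∀ x ∈ D.V, |D.wt * (D.a x * D.δG D.f x)| ≤ D.wt * M := by
    intro x hx
    rw [abs_mul, abs_of_nonneg hwt, abs_mul]
    refine mul_le_mul_of_nonneg_left ?_ hwt
    have hexp : Real.exp (-(K.δ₀ * (D.dsupp + D.dΩc x))) ≤ Real.exp (-(2 * K.δ₀ * D.R)) := by
      rw [Real.exp_le_exp]
      have := hRx x hx
      have := hK.δ₀_pos
      nlinarith
    calc |D.a x| * |D.δG D.f x|
        ≤ D.thrA K * (K.c₀ * D.thrF K * Real.exp (-(K.δ₀ * (D.dsupp + D.dΩc x)))) :=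
          mul_le_mul (ha x hx) (hδG x hx) (abs_nonneg _) hTa
      _ ≤ D.thrA K * (K.c₀ * D.thrF K * Real.exp (-(2 * K.δ₀ * D.R))) :=
          mul_le_mul_of_nonneg_left (mul_le_mul_of_nonneg_left hexp (mul_nonneg hK.c₀_nonneg hTf)) hTa
      _ = M := by rw [hM]; ring
  calc |D.diffTerm| ≤ ∑ x ∈ D.V, |D.wt * (D.a x * D.δG D.f x)| := Finset.abs_sum_le_sum_abs _ _
    _ ≤ ∑ x ∈ D.V, D.wt * M := Finset.sum_le_sum hterm
    _ = D.wt * (D.V.card : ℝ) * M := by rw [Finset.sum_const, nsmul_eq_mul]; ring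
    _ ≤ (D.vol7 : ℝ) * M := mul_le_mul_of_nonneg_right hvol hM0

/-- **One term, "O((Lᵏε)^κ)|Λ₇^{(k)}|"**: with `e^{−2δ₀r(ℓ)}·T_a(ℓ)T_f(ℓ) ≤ C_κℓ^κ` (`decay_thresholds_pow₂`) and the (2.8)
separation `R ≥ r(ℓ)`, `|T| ≤ c₀C_κ·ℓ^κ·|Λ₇^{(k)}|`. [cite: Balaban1982Higgs2, Prop. 2.6 p.580] -/
theorem abs_diffTerm_le_pow (hK : K.Printed) (h : D.Ctx K) {κ Cκ : ℝ}
    (hCκ : Real.exp (-(2 * K.δ₀ * B2.rFn K.Rr K.r D.ℓ))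
      * ((K.Ka * B2.pFn K.b₀ K.p D.ℓ * D.ℓ ^ (-K.ma)) * (K.Kf * B2.pFn K.b₀ K.p D.ℓ * D.ℓ ^ (-K.mf))) ≤ Cκ * D.ℓ ^ κ) :
    |D.diffTerm| ≤ K.c₀ * Cκ * D.ℓ ^ κ * (D.vol7 : ℝ) := by
  have h0 := abs_diffTerm_le K D hK h
  obtain ⟨hℓ, hℓ1, -, -, -, -, -, -, -, hrR⟩ := h
  have hTa : 0 ≤ D.thrA K :=
    mul_nonneg (mul_nonneg hK.Ka_nonneg (pFn_nonneg hK.b₀_nonneg hℓ hℓ1)) (Real.rpow_nonneg hℓ.le _)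
  have hTf : 0 ≤ D.thrF K :=
    mul_nonneg (mul_nonneg hK.Kf_nonneg (pFn_nonneg hK.b₀_nonneg hℓ hℓ1)) (Real.rpow_nonneg hℓ.le _)
  have hexp : Real.exp (-(2 * K.δ₀ * D.R)) ≤ Real.exp (-(2 * K.δ₀ * B2.rFn K.Rr K.r D.ℓ)) := by
    rw [Real.exp_le_exp]
    have := hK.δ₀_pos
    nlinarith
  have h1 : Real.exp (-(2 * K.δ₀ * D.R)) * D.thrA K * D.thrF K ≤ Cκ * D.ℓ ^ κ := by
    calc Real.exp (-(2 * K.δ₀ * D.R)) * D.thrA K * D.thrF K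
        ≤ Real.exp (-(2 * K.δ₀ * B2.rFn K.Rr K.r D.ℓ)) * D.thrA K * D.thrF K := by gcongr
      _ = Real.exp (-(2 * K.δ₀ * B2.rFn K.Rr K.r D.ℓ)) * (D.thrA K * D.thrF K) := by ring
      _ ≤ Cκ * D.ℓ ^ κ := hCκ
  calc |D.diffTerm| ≤ (D.vol7 : ℝ) * (K.c₀ * Real.exp (-(2 * K.δ₀ * D.R)) * D.thrA K * D.thrF K) := h0
    _ = (D.vol7 : ℝ) * K.c₀ * (Real.exp (-(2 * K.δ₀ * D.R)) * D.thrA K * D.thrF K) := by ring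
    _ ≤ (D.vol7 : ℝ) * K.c₀ * (Cκ * D.ℓ ^ κ) :=
        mul_le_mul_of_nonneg_left h1 (mul_nonneg (Nat.cast_nonneg _) hK.c₀_nonneg)
    _ = K.c₀ * Cκ * D.ℓ ^ κ * (D.vol7 : ℝ) := by ring

end Estimate

/-! ## Proposition 2.6 for the family -/

/-- **Proposition 2.6 p. 580 — the decl of record INHABITED (kind «model instance», schematic)**: for constants in the
printed ranges and EVERY real `κ`, r02's `B2Sect2Statements.Prop26Printed κ` holds for the family of all localized terms
with a propagator-difference line: ONE constant `C = c₀C_κ` with `|T| ≤ C·(Lᵏε)^κ·|Λ₇^{(k)}|` whenever the standing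
context holds (`C_κ` from `decay_thresholds_pow₂`: `e^{−2δ₀r(ℓ)}` beats the two thresholds).
[cite: Balaban1982Higgs2, Prop. 2.6 p.580] -/
theorem prop26Printed_diffTerms (K : Consts) (hK : K.Printed) (κ : ℝ) :
    B2Sect2Statements.Prop26Printed κ (diffTermFam K) := by
  obtain ⟨Cκ, -, hC⟩ := decay_thresholds_pow₂ (m₁ := K.ma) (m₂ := K.mf) (mul_pos two_pos hK.δ₀_pos) hK.Rr_pos
    hK.r_gt_one hK.b₀_nonneg hK.p_nonneg hK.Ka_nonneg hK.Kf_nonneg κ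
  refine ⟨K.c₀ * Cκ, fun i hctx => ?_⟩
  obtain ⟨n, D⟩ := i
  have hctx' : D.Ctx K := hctx
  have hℓ := hctx'.1
  have hℓ1 := hctx'.2.1
  have h := abs_diffTerm_le_pow K D hK hctx' (κ := κ) (Cκ := Cκ)
    (by simpa only [mul_assoc] using hC D.ℓ hℓ hℓ1)
  simpa only [diffTermFam, toP26, mul_assoc] using h

/-- **The p. 568 reading** (*"we estimate unnecessary terms by O((L^{k−1}ε)^κ)|…| with κ > d"*): for every dimension `d`
there is an exponent `κ > d` for which Prop. 2.6 holds for the family (indeed every κ does).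
[cite: Balaban1982Higgs2, Prop. 2.6 p.580] -/
theorem prop26Printed_diffTerms_gt_d (K : Consts) (hK : K.Printed) (d : ℕ) :
    ∃ κ : ℝ, (d : ℝ) < κ ∧ B2Sect2Statements.Prop26Printed κ (diffTermFam K) :=
  ⟨d + 1, by linarith, prop26Printed_diffTerms K hK _⟩

/-! ## Non-vacuity of the context -/

/-- A one-vertex datum at the scale `ℓ = 1` with vanishing factors: the context is satisfiable, so the family is not
vacuous (`r(1) = R`, `p(1) = b₀`). [cite: Balaban1982Higgs2, Prop. 2.6 p.580] -/
def witness (K : Consts) : Datum 1 :=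
  { ℓ := 1, wt := 1, V := Finset.univ, vol7 := 1, a := fun _ => 0, f := fun _ => 0, δG := fun _ => fun _ => 0,
    dΩc := fun _ => K.Rr, dsupp := K.Rr, R := K.Rr }

/-- `r(1) = R`: at `ℓ = 1` the logarithm vanishes. [cite: Balaban1982Higgs2, (2.7) p.558] -/
theorem rFn_one (Rr r : ℝ) : B2.rFn Rr r 1 = Rr := by
  simp [B2.rFn]

/-- **The context is satisfiable**: `(witness K).Ctx K` for constants in the printed ranges.
[cite: Balaban1982Higgs2, Prop. 2.6 p.580] -/
theorem ctx_witness (K : Consts) (hK : K.Printed) : (witness K).Ctx K := by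
  have hp0 : 0 ≤ B2.pFn K.b₀ K.p 1 := pFn_nonneg hK.b₀_nonneg one_pos le_rfl
  have hTa : 0 ≤ (witness K).thrA K := by
    unfold Datum.thrA witness
    exact mul_nonneg (mul_nonneg hK.Ka_nonneg hp0) (Real.rpow_nonneg zero_le_one _)
  have hTf : 0 ≤ (witness K).thrF K := by
    unfold Datum.thrF witness
    exact mul_nonneg (mul_nonneg hK.Kf_nonneg hp0) (Real.rpow_nonneg zero_le_one _)
  refine ⟨one_pos, le_rfl, zero_le_one, ?_, ?_, ?_, ?_, le_rfl, fun _ _ => le_rfl, ?_⟩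
  · simp [witness]
  · intro x _
    simpa [witness] using hTa
  · intro x
    simpa [witness] using hTf
  · intro x _
    have : (0 : ℝ) ≤ K.c₀ * (witness K).thrF K * Real.exp (-(K.δ₀ * (K.Rr + K.Rr))) :=
      mul_nonneg (mul_nonneg hK.c₀_nonneg hTf) (Real.exp_pos _).le
    simpa [witness] using this
  · show B2.rFn K.Rr K.r (witness K).ℓ ≤ (witness K).R
    simp only [witness, rFn_one, le_refl]

end Literature.MathematicalPhysics.QuantumFieldTheory.Balaban1983to89.B2Prop26DiffTerms
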